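import Summits.AtomisticToContinuum.HydrodynamicLimit.Theorems.JParityClosureLocalSecondLawLedgerDefs
import Summits.AtomisticToContinuum.HydrodynamicLimit.Theorems.JParityClosureDensityCapGridUpgrade
import Literature.Analysis.FunctionSpaces.TorusRademacher
import Literature.Analysis.FluidPDE.HardSpherePhaseSpaceProofs
import Mathlib.MeasureTheory.Measure.Haar.Unique

/-!
# Entropy ledger for `JParityClosure.LocalSecondLaw` — kernel calculus
(stmt-AtomisticToContinuum-13081, line `exact-entropy-ledger-three-passivities`, layer 1 of stub L)

The cone mollifier `b_r(y, x₀) = (3/(πr³))(1 - d(y,x₀)/r)₊` of the crux depends on `y - x₀` only and is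
Lipschitz on `𝕋³`; by Rademacher on the torus (`Torus.ae_differentiableAt_liftAt`) it is differentiable at
almost every field point, and at such points the SAME-KERNEL identity `∂_δ b(y + δv, x) = D b · v = -∑ v_k ∂_{x,k} b`
holds.  We also record the cone-mollified empirical fields `ρ_r, m_r, e_r`, the second and (half) third
velocity moments `M_r, Q_r`, the coarse velocity, traceless stress and kinetic heat current as finite particle
sums and as polynomial expressions in the linear moments.

References: R. J. Hardy, J. Chem. Phys. 76 (1982) 622 (bond functions); H. Federer, *Geometric Measure
Theory* (1969) 3.1.6 (Rademacher).
-/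

noncomputable section

namespace Summit.AtomisticToContinuum.HydrodynamicLimit.Theorems.LocalSecondLawLedger

open scoped BigOperators Topology ENNReal InnerProductSpace
open Filter Set MeasureTheory
open Literature.MathematicalPhysics.KineticTheory
open Literature.Analysis.FluidPDE
open Literature.Analysis.FunctionSpaces
open Summit.AtomisticToContinuum.HydrodynamicLimit.Theorems.LocalSecondLawNegative

namespace L

variable {N : ℕ}

/-! ## The cone kernel as a Lipschitz function of `y - x₀` -/

/-- The cone kernel depends on `y - x₀` only. [folklore] -/
theorem cone_eq_sub (r : ℝ) (y x : T3) : cone r y x = cone r (y - x) 0 := by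
  simp [cone, Torus.euclidDist_eq, sub_zero]

/-- `|b_r(y,x₀)| ≤ 3/(πr³)`. [folklore] -/
theorem abs_cone_le {r : ℝ} (hr : 0 < r) (y x : T3) : |cone r y x| ≤ 3 / (Real.pi * r ^ 3) := by
  rw [abs_of_nonneg (cone_nonneg hr y x)]
  exact DensityCapNegative.cone_le hr y x

/-- The minimal-image distance is dominated by `√3` times the product distance of `𝕋³`. [folklore] -/
theorem euclidDist_le_sqrt3_mul_dist (y y' : T3) : Torus.euclidDist y y' ≤ Real.sqrt 3 * dist y y' := by
  have h := Torus.euclidDist_le_holds (d := Fin 3) y y'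
  rw [Fintype.card_fin] at h
  simpa [dist_eq_norm] using h

/-- The Lipschitz constant `3√3/(πr⁴)` of the cone kernel on `𝕋³` (product metric). [folklore] -/
def coneLip (r : ℝ) : NNReal := ⟨3 / (Real.pi * r ^ 4) * Real.sqrt 3, by positivity⟩

/-- The value of the Lipschitz constant. [folklore] -/
theorem coe_coneLip (r : ℝ) : (coneLip r : ℝ) = 3 / (Real.pi * r ^ 4) * Real.sqrt 3 := rfl

/-- The cone kernel is Lipschitz in the particle position. [folklore] -/
theorem lipschitzWith_cone_left {r : ℝ} (hr : 0 < r) (x : T3) : LipschitzWith (coneLip r) fun y => cone r y x := by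
  refine LipschitzWith.of_dist_le_mul fun y y' => ?_
  rw [Real.dist_eq, coe_coneLip]
  calc |cone r y x - cone r y' x| ≤ 3 / (Real.pi * r ^ 4) * Torus.euclidDist y y' :=
        gridUp_abs_cone_sub_cone_le hr y y' x
    _ ≤ 3 / (Real.pi * r ^ 4) * (Real.sqrt 3 * dist y y') :=
        mul_le_mul_of_nonneg_left (euclidDist_le_sqrt3_mul_dist y y') (by positivity)
    _ = 3 / (Real.pi * r ^ 4) * Real.sqrt 3 * dist y y' := by ring

/-- The cone kernel, as a function of `y - x₀`, is Lipschitz on `𝕋³`. [folklore] -/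
theorem lipschitzWith_cone_zero {r : ℝ} (hr : 0 < r) : LipschitzWith (coneLip r) fun z : T3 => cone r z 0 :=
  lipschitzWith_cone_left hr 0

/-- The cone kernel is Lipschitz in the field point. [folklore] -/
theorem lipschitzWith_cone_right {r : ℝ} (hr : 0 < r) (y : T3) : LipschitzWith (coneLip r) (cone r y) := by
  refine LipschitzWith.of_dist_le_mul fun x x' => ?_
  have h := (lipschitzWith_cone_zero hr).dist_le_mul (y - x) (y - x')
  rw [← cone_eq_sub, ← cone_eq_sub] at h
  refine h.trans (mul_le_mul_of_nonneg_left ?_ (coneLip r).2)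
  rw [dist_eq_norm, dist_eq_norm, sub_sub_sub_cancel_left, norm_sub_rev]

/-! ## Differentiability of the kernel at almost every field point and the same-kernel identity -/

/-- At a field point where the kernel `z ↦ b_r(z, 0)` is differentiable at `y - x`, the kernel is differentiable
along every line through the field point, with derivative `-D b(y - x) e` (same-kernel identity, field side).
[folklore] -/
theorem hasDerivAt_cone_field {r : ℝ} {y x : T3}
    (h : DifferentiableAt ℝ (Torus.liftAt (fun z : T3 => cone r z 0) (y - x)) 0) (e : V3) :
    HasDerivAt (fun t : ℝ => cone r y (x + Torus.proj (t • e)))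
      (-(Torus.fderiv (fun z : T3 => cone r z 0) (y - x) e)) 0 := by
  have hL : HasFDerivAt (Torus.liftAt (fun z : T3 => cone r z 0) (y - x))
      (Torus.fderiv (fun z : T3 => cone r z 0) (y - x)) ((-(0 : ℝ)) • e) := by
    rw [neg_zero, zero_smul]; exact h.hasFDerivAt
  have hc : HasDerivAt (fun t : ℝ => (-t) • e) ((-1 : ℝ) • e) 0 := by
    simpa using ((hasDerivAt_id (0 : ℝ)).neg).smul_const e
  have hcomp := hL.comp_hasDerivAt (0 : ℝ) hc
  have heq : (Torus.liftAt (fun z : T3 => cone r z 0) (y - x)) ∘ (fun t : ℝ => (-t) • e) =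
      fun t : ℝ => cone r y (x + Torus.proj (t • e)) := by
    funext t
    simp only [Function.comp_apply, Torus.liftAt_apply]
    rw [cone_eq_sub r y]
    congr 1
    rw [neg_smul, Torus.proj_neg]
    abel
  rw [heq] at hcomp
  simpa using hcomp

/-- At a field point where the kernel is differentiable at `y - x`, the kernel read at the freely moving particle
`y + δ v` is differentiable in `δ`, with derivative `D b(y - x) v` (same-kernel identity, particle side).
[folklore] -/
theorem hasDerivAt_cone_flight {r : ℝ} {y x : T3}
    (h : DifferentiableAt ℝ (Torus.liftAt (fun z : T3 => cone r z 0) (y - x)) 0) (v : V3) :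
    HasDerivAt (fun t : ℝ => cone r (y + Torus.proj (t • v)) x)
      (Torus.fderiv (fun z : T3 => cone r z 0) (y - x) v) 0 := by
  have hL : HasFDerivAt (Torus.liftAt (fun z : T3 => cone r z 0) (y - x))
      (Torus.fderiv (fun z : T3 => cone r z 0) (y - x)) ((0 : ℝ) • v) := by
    rw [zero_smul]; exact h.hasFDerivAt
  have hc : HasDerivAt (fun t : ℝ => t • v) ((1 : ℝ) • v) 0 := by
    simpa using (hasDerivAt_id (0 : ℝ)).smul_const v
  have hcomp := hL.comp_hasDerivAt (0 : ℝ) hc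
  have heq : (Torus.liftAt (fun z : T3 => cone r z 0) (y - x)) ∘ (fun t : ℝ => t • v) =
      fun t : ℝ => cone r (y + Torus.proj (t • v)) x := by
    funext t
    simp only [Function.comp_apply, Torus.liftAt_apply]
    rw [cone_eq_sub r (y + _)]
    congr 1
    abel
  rw [heq] at hcomp
  simpa using hcomp

/-- The same-kernel identity in coordinates: `D b(z) v = ∑ₖ vₖ D b(z) eₖ`. [folklore] -/
theorem fderiv_cone_apply_eq_sum (r : ℝ) (z : T3) (v : V3) :
    Torus.fderiv (fun z : T3 => cone r z 0) z v =
      ∑ k : Fin 3, v k * Torus.fderiv (fun z : T3 => cone r z 0) z (EuclideanSpace.single k 1) := by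
  have hv : ∑ k : Fin 3, v k • EuclideanSpace.single k (1 : ℝ) = v := by
    conv_rhs => rw [← (EuclideanSpace.basisFun (Fin 3) ℝ).sum_repr v]
    simp [EuclideanSpace.basisFun_apply]
  conv_lhs => rw [← hv]
  simp [map_sum, map_smul, smul_eq_mul]

/-- **Rademacher for the cone fields.** For every configuration, at almost every field point all the kernels
`b_r(xᵢ, ·)` are differentiable. [folklore] -/
theorem ae_differentiableAt_cone {r : ℝ} (hr : 0 < r) (w : Phase N) :
    ∀ᵐ x : T3, ∀ i : Fin (N + 1),
      DifferentiableAt ℝ (Torus.liftAt (fun z : T3 => cone r z 0) ((w i).1 - x)) 0 :=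
  ae_all_iff.2 fun i => Torus.ae_differentiableAt_liftAt_sub (lipschitzWith_cone_zero hr) (w i).1

/-- The kernel derivative is bounded by the Lipschitz constant: `|D b(z) v| ≤ (3√3/(πr⁴)) ‖v‖`. [folklore] -/
theorem abs_fderiv_cone_le {r : ℝ} (hr : 0 < r) (z : T3) (v : V3) :
    |Torus.fderiv (fun z : T3 => cone r z 0) z v| ≤ coneLip r * ‖v‖ := by
  rw [← Real.norm_eq_abs]
  exact Torus.norm_torusFderiv_apply_le_of_lipschitz (lipschitzWith_cone_zero hr) z v

/-- The kernel derivative `(z, v) ↦ D b(xᵢ - x) v` is measurable in the field point. [folklore] -/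
theorem measurable_fderiv_cone_sub (r : ℝ) (y : T3) (v : V3) :
    Measurable fun x : T3 => Torus.fderiv (fun z : T3 => cone r z 0) (y - x) v :=
  ((ContinuousLinearMap.apply ℝ ℝ v).measurable.comp (Torus.measurable_torusFderiv _)).comp
    (measurable_const.sub measurable_id)

/-! ## The cone fields as particle sums -/

/-- Integrals of vector-valued observables against the empirical measure are particle averages. [folklore] -/
theorem integral_empiricalMeasure_vec {E : Type*} [NormedAddCommGroup E] [NormedSpace ℝ E] [CompleteSpace E]
    (w : Phase N) (f : T3 × V3 → E) :
    ∫ q, f q ∂(empiricalMeasure w) = ((N + 1 : ℕ) : ℝ)⁻¹ • ∑ i, f (w i) := by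
  rw [empiricalMeasure, integral_smul_measure, integral_finsetSum_measure]
  · simp only [integral_dirac]
    congr 1
    rw [ENNReal.toReal_inv, ENNReal.toReal_natCast]
  · exact fun i _ => integrable_dirac (by simp)

/-- The mollified density as a particle average (the canonical copy `rhoC_eq_sum` lives in the sibling module
`KineticStressAlgebra`, not importable here). [folklore] -/
theorem rhoC_eq_sum (r : ℝ) (w : Phase N) (x : T3) :
    rhoC r w x = ((N + 1 : ℕ) : ℝ)⁻¹ * ∑ i : Fin (N + 1), cone r (w i).1 x := by
  unfold rhoC; rw [integral_empiricalMeasure]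

/-- The mollified momentum as a particle average. [folklore] -/
theorem momC_eq_sum (r : ℝ) (w : Phase N) (x : T3) :
    momC r w x = ((N + 1 : ℕ) : ℝ)⁻¹ • ∑ i : Fin (N + 1), cone r (w i).1 x • (w i).2 := by
  unfold momC; rw [integral_empiricalMeasure_vec]

/-- Components of the mollified momentum as particle averages. [folklore] -/
theorem momC_apply_eq_sum (r : ℝ) (w : Phase N) (x : T3) (k : Fin 3) :
    momC r w x k = ((N + 1 : ℕ) : ℝ)⁻¹ * ∑ i : Fin (N + 1), cone r (w i).1 x * (w i).2 k := by
  rw [momC_eq_sum]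
  simp [Finset.smul_sum, smul_eq_mul, Finset.mul_sum]

/-- Components of the coarse velocity `u_r = m_r / ρ_r`. [folklore] -/
theorem uC_apply (r : ℝ) (w : Phase N) (x : T3) (k : Fin 3) : (uC r w x) k = (rhoC r w x)⁻¹ * (momC r w x) k := by
  simp [uC]

/-- The second velocity moment `M_{kl} = (N+1)⁻¹ ∑ᵢ b(xᵢ,x₀) vᵢₖ vᵢₗ`. [folklore] -/
def Mmom (r : ℝ) (w : Phase N) (x : T3) (k l : Fin 3) : ℝ :=
  ((N + 1 : ℕ) : ℝ)⁻¹ * ∑ i, cone r (w i).1 x * ((w i).2 k * (w i).2 l)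

/-- The half third velocity moment `Q_k = (N+1)⁻¹ ∑ᵢ b(xᵢ,x₀) (|vᵢ|²/2) vᵢₖ` (free energy current). [folklore] -/
def Qmom (r : ℝ) (w : Phase N) (x : T3) (k : Fin 3) : ℝ :=
  ((N + 1 : ℕ) : ℝ)⁻¹ * ∑ i, cone r (w i).1 x * (‖(w i).2‖ ^ 2 / 2 * (w i).2 k)

/-- `‖v‖² = ∑ₖ vₖ²` on `ℝ³`. [folklore] -/
theorem norm_sq_eq_sum (v : V3) : ‖v‖ ^ 2 = ∑ k : Fin 3, v k ^ 2 := by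
  rw [EuclideanSpace.norm_eq, Real.sq_sqrt (Finset.sum_nonneg fun _ _ => by positivity)]
  simp [Real.norm_eq_abs, sq_abs]

/-- The mollified kinetic energy is half the trace of the second moment. [folklore] -/
theorem kinC_eq_trace (r : ℝ) (w : Phase N) (x : T3) :
    kinC r w x = (∑ k : Fin 3, Mmom r w x k k) / 2 := by
  rw [kinC_eq_sum]
  unfold Mmom
  rw [← Finset.mul_sum, mul_div_assoc]
  congr 1
  rw [Finset.sum_comm, Finset.sum_div]
  refine Finset.sum_congr rfl fun i _ => ?_
  rw [← Finset.mul_sum, norm_sq_eq_sum]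
  simp only [pow_two]
  ring

/-- The second moment is symmetric. [folklore] -/
theorem Mmom_symm (r : ℝ) (w : Phase N) (x : T3) (k l : Fin 3) : Mmom r w x k l = Mmom r w x l k := by
  unfold Mmom; congr 1; refine Finset.sum_congr rfl fun i _ => ?_; ring

/-- The temperature through the components of the momentum. [folklore] -/
theorem thetaC_eq (r : ℝ) (w : Phase N) (x : T3) :
    thetaC r w x = 2 / 3 * (kinC r w x / rhoC r w x - (∑ k : Fin 3, momC r w x k ^ 2) / (2 * rhoC r w x ^ 2)) := by
  rw [thetaC, norm_sq_eq_sum]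

/-- The traceless stress as a polynomial in the linear moments:
`Σ^dev_{kl} = M_{kl} - u_k m_l - m_k u_l + ρ u_k u_l - ρθ δ_{kl}`. [folklore] -/
theorem devC_eq (r : ℝ) (w : Phase N) (x : T3) (k l : Fin 3) :
    devC r w x k l = Mmom r w x k l - uC r w x k * momC r w x l - momC r w x k * uC r w x l
      + rhoC r w x * uC r w x k * uC r w x l - rhoC r w x * thetaC r w x * (if k = l then 1 else 0) := by
  unfold devC
  rw [sub_left_inj, integral_empiricalMeasure]
  unfold Mmom
  rw [rhoC_eq_sum, momC_apply_eq_sum, momC_apply_eq_sum]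
  simp only [Finset.mul_sum, Finset.sum_mul, ← Finset.sum_sub_distrib, ← Finset.sum_add_distrib]
  refine Finset.sum_congr rfl fun i _ => ?_
  ring

/-- The cubic peculiar moment of one particle, expanded in powers of the particle velocity. [folklore] -/
theorem peculiar_cubic_expand (v u : V3) (k : Fin 3) :
    ‖v - u‖ ^ 2 / 2 * (v k - u k) = ‖v‖ ^ 2 / 2 * v k - u k * (‖v‖ ^ 2 / 2) - ∑ l : Fin 3, u l * (v l * v k)
      + u k * (∑ l : Fin 3, u l * v l) + (∑ l : Fin 3, u l ^ 2) / 2 * (v k - u k) := by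
  rw [norm_sq_eq_sum, norm_sq_eq_sum]
  simp only [PiLp.sub_apply, Fin.sum_univ_three]
  ring

/-- The kinetic heat current as a polynomial in the linear moments:
`q_k = Q_k - u_k e - ∑ₗ uₗ M_{lk} + u_k (u·m) + (|u|²/2)(m_k - ρ u_k)`. [folklore] -/
theorem qkinC_eq (r : ℝ) (w : Phase N) (x : T3) (k : Fin 3) :
    qkinC r w x k = Qmom r w x k - uC r w x k * kinC r w x - ∑ l : Fin 3, uC r w x l * Mmom r w x l k
      + uC r w x k * (∑ l : Fin 3, uC r w x l * momC r w x l)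
      + (∑ l : Fin 3, uC r w x l ^ 2) / 2 * (momC r w x k - rhoC r w x * uC r w x k) := by
  unfold qkinC Qmom Mmom
  rw [integral_empiricalMeasure_vec, kinC_eq_sum, rhoC_eq_sum]
  simp only [momC_apply_eq_sum]
  have happ : (((N + 1 : ℕ) : ℝ)⁻¹ • ∑ i : Fin (N + 1),
      (cone r (w i).1 x * (‖(w i).2 - uC r w x‖ ^ 2 / 2)) • ((w i).2 - uC r w x)) k =
      ((N + 1 : ℕ) : ℝ)⁻¹ * ∑ i : Fin (N + 1),
        cone r (w i).1 x * (‖(w i).2 - uC r w x‖ ^ 2 / 2 * ((w i).2 k - uC r w x k)) := by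
    rw [PiLp.smul_apply, smul_eq_mul, WithLp.ofLp_sum, Finset.sum_apply]
    congr 1
    refine Finset.sum_congr rfl fun i _ => ?_
    rw [WithLp.ofLp_smul, Pi.smul_apply, smul_eq_mul, PiLp.sub_apply]
    ring
  rw [happ]
  simp only [Fin.sum_univ_three, mul_sub, Finset.mul_sum, Finset.sum_mul, ← Finset.sum_sub_distrib,
    ← Finset.sum_add_distrib]
  refine Finset.sum_congr rfl fun i _ => ?_
  rw [norm_sq_eq_sum ((w i).2 - uC r w x), norm_sq_eq_sum (w i).2]
  simp only [PiLp.sub_apply, Fin.sum_univ_three]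
  ring

end L

/-- **Layer 1 of the entropy ledger (registered sub-goal `ledgerL_kernel`).** Rademacher for the cone fields:
for every configuration, at almost every field point all the kernels `b_r(xᵢ, ·)` are differentiable.
[folklore] -/
theorem ledgerL_kernel :
  ∀ {N : ℕ} {r : ℝ}, 0 < r → ∀ (w : Phase N), ∀ᵐ x : T3, ∀ i : Fin (N + 1), DifferentiableAt ℝ (Literature.Analysis.FunctionSpaces.Torus.liftAt (fun z : T3 => cone r z 0) ((w i).1 - x)) 0 :=
  fun hr w => L.ae_differentiableAt_cone hr w

end Summit.AtomisticToContinuum.HydrodynamicLimit.Theorems.LocalSecondLawLedger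

end

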